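import Literature.Analysis.FluidPDE.DynamicRescalingVelocityRate
import HarnessLib

/-!
# Sub-Leray envelopes exclude blow-up; the velocity clock for a ratio pinned only EVENTUALLY

Topic `Literature/Analysis/FluidPDE`; sequel of `DynamicRescalingVelocityRate.lean` (same setting
and notation: continuous exponents `c_u, c_l`, time clock `C_u = rescalingFactor c_u`,
`t = rescaledTime C_u`, `T = blowupTime C_u`, length clock `C_l = rescalingFactor (−c_l)`, ratio
`ĉ_l = c_l/|c_u|`; Hou 2026 §3, pp. 10–11 of the held text). Two things the first file leaves
implicit are made explicit here.

1. **The rescaling-free core** (`not_isMaximalSmoothSolution_of_subLeray_envelope`): Leray's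
   necessary rate (ns.S28, `leray_blowup_rate_top_holds`, KERNEL) forbids ANY envelope
   `‖u(s, x)‖ ≤ K (T − s)^{γ−1}` with `γ > ½` on `[0, T)` for a maximal smooth Leray–Hopf solution
   of lifespan `T` — the envelope itself discharges the essential boundedness on the earlier
   slabs that ns.S28 asks for. This is the hook for every DRIFTING object whose fitted velocity
   exponent stays on the slow side of Leray's `(T − t)^{−1/2}`, however the fit was produced.
2. **Ratio pinned only after a transient.** A computed fit `ĉ_l(τ)` typically settles only after
   an initial transient. If `γ (−c_u(s)) ≤ c_l(s)` holds for `s ≥ τ₀` only, the length clock is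
   still dominated by the `γ`-power of the time clock UP TO A CONSTANT,
   `C_l(τ) ≤ K C_u(τ)^γ` for all `τ ≥ 0` (`exists_lengthFactor_le_mul_rpow_clockFactor_of_eventually`:
   monotonicity of the integral on `[τ₀, τ]`, compactness on `[0, τ₀]`), and every conclusion of
   the first file survives with that constant: the sub-Leray envelope
   (`speed_le_of_lengthFactor_le`) and the exclusion at the lifespan
   (`not_isMaximalSmoothSolution_of_lengthFactor_le`,
   `not_isMaximalSmoothSolution_of_rescaling_of_eventually_half_lt`).

The time clock itself is kept pinned from `τ = 0` (`−b ≤ c_u ≤ −a < 0` on `[0, ∞)`, i.e.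
`C_u ≍ T − t`, `rescalingFactor_mem_Icc`): in Hou's gauge `c_u = −N(p)` is minus the growth rate
of `‖u₁‖_∞`, negative along a collapsing run.

## WHAT THIS IS NOT
Real-variable bookkeeping plus one composition with a kernel theorem; no profile is constructed,
no existence or blow-up is asserted, nothing is claimed about any computed trajectory.
-/

noncomputable section

open MeasureTheory Set Filter Function intervalIntegral
open _root_.Topology
open scoped ENNReal

namespace Literature.Analysis.FluidPDE

/-! ### The rescaling-free core: a sub-Leray envelope up to `T` is not a blow-up at `T` -/

section Envelope

/-- For `γ > ½`, `K (T − s)^{γ − ½} → 0` as `s ↑ T`. [folklore] -/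
private theorem tendsto_const_mul_rpow_sub_nhdsLT {T γ : ℝ} (hγ : 1 / 2 < γ) (K : ℝ) :
    Tendsto (fun s => K * (T - s) ^ (γ - 1 / 2)) (𝓝[<] T) (𝓝 0) := by
  have h1 : Tendsto (fun s : ℝ => T - s) (𝓝[<] T) (𝓝 0) := by
    have : Tendsto (fun s : ℝ => T - s) (𝓝 T) (𝓝 (T - T)) :=
      (continuous_const.sub continuous_id).tendsto T
    rw [sub_self] at this
    exact this.mono_left nhdsWithin_le_nhds
  have h2 : ContinuousAt (fun r : ℝ => r ^ (γ - 1 / 2)) 0 :=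
    Real.continuousAt_rpow_const 0 _ (Or.inr (by linarith))
  have h3 := h2.tendsto.comp h1
  rw [Function.comp_def, Real.zero_rpow (by linarith : (γ - 1 / 2 : ℝ) ≠ 0)] at h3
  simpa using h3.const_mul K

/-- **A sub-Leray envelope up to `T` is not a blow-up at `T`.** Let `ν > 0`, `T > 0`, `γ > ½` and
let `(u, p)` be a maximal smooth solution of the unforced Navier–Stokes system on `ℝ³ × [0, T)`
(`IsMaximalSmoothSolution ν 0 u p T`), Leray–Hopf from `u 0`. Then NO bound
`‖u(s, x)‖ ≤ K (T − s)^{γ−1}` can hold for all `s ∈ [0, T)` and all `x`: such an envelope makes the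
solution essentially bounded on every `[0, T'] × ℝ³` (`T' < T`) and gives
`‖u(s)‖_∞ √(T − s) ≤ K (T − s)^{γ−½} → 0`, against Leray's `c √ν ≤ √(T − s) ‖u(s)‖_∞` on `[0, T)`
(ns.S28, `leray_blowup_rate_top_holds`; Leray 1934 §19 (3.9)). Rescaling-free form of
`not_isMaximalSmoothSolution_of_rescaling_of_half_lt`. [cite: Leray1934, §19 (3.8)–(3.9) p. 224] -/
theorem not_isMaximalSmoothSolution_of_subLeray_envelope {ν T γ K : ℝ} (hν : 0 < ν) (hT : 0 < T)
    (hγ : 1 / 2 < γ)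
    {u : ℝ → EuclideanSpace ℝ (Fin 3) → EuclideanSpace ℝ (Fin 3)}
    {p : ℝ → EuclideanSpace ℝ (Fin 3) → ℝ}
    (hmax : IsMaximalSmoothSolution ν 0 u p T) (hLH : IsLerayHopfOn T ν 0 (u 0) u)
    (henv : ∀ s ∈ Ico 0 T, ∀ x, ‖u s x‖ ≤ K * (T - s) ^ (γ - 1)) : False := by
  -- `K ≥ 0` (the envelope bounds a norm at `s = 0`)
  have hK0 : 0 ≤ K := by
    have h := henv 0 ⟨le_rfl, hT⟩ 0
    have hpow : 0 < (T - 0) ^ (γ - 1) := Real.rpow_pos_of_pos (by simpa using hT) _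
    exact nonneg_of_mul_nonneg_left ((norm_nonneg _).trans h) hpow
  -- essential boundedness on the closed sub-slabs `[0, T'] × ℝ³`
  have hbdd : ∀ T' ∈ Ioo 0 T,
      eLpNorm (uncurry u) ∞ (volume.restrict (Icc 0 T' ×ˢ univ)) < ∞ := by
    intro T' hT'
    have hTT' : 0 < T - T' := sub_pos.2 hT'.2
    rw [eLpNorm_exponent_top]
    refine eLpNormEssSup_lt_top_of_ae_bound
      (C := K * ((T - T') ^ (γ - 1) + T ^ (γ - 1))) ?_
    rw [ae_restrict_iff' (measurableSet_Icc.prod MeasurableSet.univ)]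
    refine ae_of_all _ ?_
    rintro ⟨s, x⟩ ⟨hs, -⟩
    have hsT : s ∈ Ico 0 T := ⟨hs.1, hs.2.trans_lt hT'.2⟩
    have hTs : 0 < T - s := sub_pos.2 hsT.2
    refine (henv s hsT x).trans (mul_le_mul_of_nonneg_left ?_ hK0)
    rcases le_or_gt γ 1 with hγ1 | hγ1
    · have h1 : (T - s) ^ (γ - 1) ≤ (T - T') ^ (γ - 1) :=
        Real.rpow_le_rpow_of_nonpos hTT' (by linarith [hs.2]) (by linarith)
      linarith [Real.rpow_nonneg hT.le (γ - 1)]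
    · have h1 : (T - s) ^ (γ - 1) ≤ T ^ (γ - 1) :=
        Real.rpow_le_rpow hTs.le (by linarith [hs.1]) (by linarith)
      linarith [Real.rpow_nonneg hTT'.le (γ - 1)]
  obtain ⟨c, hc, hrate⟩ := leray_blowup_rate_top_holds
  have hcν : 0 < c * Real.sqrt ν := mul_pos hc (Real.sqrt_pos.2 hν)
  -- a time `s ∈ (0, T)` with `K (T − s)^{γ−½} ≤ c√ν/2`
  have hev := (tendsto_const_mul_rpow_sub_nhdsLT (T := T) hγ K).eventually_lt_const
    (half_pos hcν)
  obtain ⟨s, hsε, hsI⟩ := (hev.and (Ioo_mem_nhdsLT hT)).exists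
  have hTs : 0 < T - s := sub_pos.2 hsI.2
  have hsq : 0 < Real.sqrt (T - s) := Real.sqrt_pos.2 hTs
  have hup : eLpNorm (u s) ∞ volume ≤ ENNReal.ofReal (K * (T - s) ^ (γ - 1)) := by
    rw [eLpNorm_exponent_top]
    exact eLpNormEssSup_le_of_ae_bound (ae_of_all _ fun x => henv s ⟨hsI.1.le, hsI.2⟩ x)
  have hlow := hrate ν T hν hT u p hmax hLH hbdd s ⟨hsI.1.le, hsI.2⟩
  have h := (ENNReal.ofReal_le_ofReal_iff
    (mul_nonneg hK0 (Real.rpow_nonneg hTs.le _))).1 (hlow.trans hup)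
  -- `c√ν/√(T−s) ≤ K (T−s)^{γ−1}` ⇒ `c√ν ≤ K (T−s)^{γ−½} < c√ν/2`
  rw [div_le_iff₀ hsq] at h
  have hexp : K * (T - s) ^ (γ - 1) * Real.sqrt (T - s) = K * (T - s) ^ (γ - 1 / 2) := by
    rw [Real.sqrt_eq_rpow, mul_assoc, ← Real.rpow_add hTs,
      show γ - 1 + 1 / 2 = γ - 1 / 2 by ring]
  rw [hexp] at h
  linarith

end Envelope

/-! ### The clock lemma and the `K`-versions of the velocity clock -/

section Clock

variable {cu cl : ℝ → ℝ}

/-- **The time clock against the physical clock, velocity exponent.** If `−b ≤ c_u ≤ −a < 0` on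
`[0, ∞)` then for `γ ≥ ½` and `τ ≥ 0`: `C_u(τ)^{γ−1} ≤ b^{γ−½} a^{−½} (T − t(τ))^{γ−1}` (split
`C_u^{γ−1} = C_u^{γ−½} C_u^{−½}` and use `a (T − t) ≤ C_u ≤ b (T − t)` on each factor).
[cite: Hou2026, §3 (scaling formulas 1/C_u = 1/(T−t))] -/
theorem rpow_clockFactor_le_of_pinned_clock (hcu : Continuous cu) {a b : ℝ} (ha : 0 < a)
    (hca : ∀ s, 0 ≤ s → cu s ≤ -a) (hcb : ∀ s, 0 ≤ s → -b ≤ cu s) {γ : ℝ} (hγ : 1 / 2 ≤ γ)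
    {τ : ℝ} (hτ : 0 ≤ τ) :
    rescalingFactor cu τ ^ (γ - 1) ≤ (b ^ (γ - 1 / 2) * a ^ (-(1 / 2 : ℝ))) *
      (blowupTime (rescalingFactor cu) - rescaledTime (rescalingFactor cu) τ) ^ (γ - 1) := by
  have hCu := rescalingFactor_pos cu τ
  have hlow := mul_sub_rescaledTime_le_rescalingFactor hcu ha hca hτ
  have hup := rescalingFactor_le_mul_sub_rescaledTime hcu ha hca hcb hτ
  have hTt : 0 < blowupTime (rescalingFactor cu) - rescaledTime (rescalingFactor cu) τ :=
    sub_pos.2 (rescaledTime_lt_blowupTime (continuous_rescalingFactor hcu) (rescalingFactor_pos cu)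
      (integrableOn_rescalingFactor hcu ha hca) τ)
  have haT : 0 < a * (blowupTime (rescalingFactor cu) - rescaledTime (rescalingFactor cu) τ) :=
    mul_pos ha hTt
  have hb : 0 < b := pos_of_mul_pos_left (hCu.trans_le hup) hTt.le
  have hsplit : rescalingFactor cu τ ^ (γ - 1) =
      rescalingFactor cu τ ^ (γ - 1 / 2) * rescalingFactor cu τ ^ (-(1 / 2 : ℝ)) := by
    rw [← Real.rpow_add hCu]; congr 1; ring
  have hA : rescalingFactor cu τ ^ (γ - 1 / 2) ≤
      (b * (blowupTime (rescalingFactor cu) - rescaledTime (rescalingFactor cu) τ)) ^ (γ - 1 / 2) :=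
    Real.rpow_le_rpow hCu.le hup (by linarith)
  have hB : rescalingFactor cu τ ^ (-(1 / 2 : ℝ)) ≤
      (a * (blowupTime (rescalingFactor cu) - rescaledTime (rescalingFactor cu) τ)) ^
        (-(1 / 2 : ℝ)) :=
    Real.rpow_le_rpow_of_nonpos haT hlow (by norm_num)
  rw [hsplit]
  calc rescalingFactor cu τ ^ (γ - 1 / 2) * rescalingFactor cu τ ^ (-(1 / 2 : ℝ))
      ≤ (b * (blowupTime (rescalingFactor cu) - rescaledTime (rescalingFactor cu) τ)) ^ (γ - 1 / 2) *
        (a * (blowupTime (rescalingFactor cu) - rescaledTime (rescalingFactor cu) τ)) ^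
          (-(1 / 2 : ℝ)) :=
        mul_le_mul hA hB (Real.rpow_nonneg hCu.le _) (Real.rpow_nonneg (mul_pos hb hTt).le _)
    _ = (b ^ (γ - 1 / 2) * a ^ (-(1 / 2 : ℝ))) *
        (blowupTime (rescalingFactor cu) - rescaledTime (rescalingFactor cu) τ) ^ (γ - 1) := by
        rw [Real.mul_rpow hb.le hTt.le, Real.mul_rpow ha.le hTt.le,
          show γ - 1 = (γ - 1 / 2) + (-(1 / 2 : ℝ)) by ring, Real.rpow_add hTt]
        ring

/-- **Ratio pinned only after a transient.** If `γ (−c_u(s)) ≤ c_l(s)` for `s ≥ τ₀` (nothing is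
assumed before `τ₀`), then there is `K > 0` with `C_l(τ) ≤ K C_u(τ)^γ` for ALL `τ ≥ 0`: on
`[τ₀, ∞)` with `K = C_l(τ₀)/C_u(τ₀)^γ` (monotonicity of the integral on `[τ₀, τ]`), on `[0, τ₀]`
by compactness (`C_l/C_u^γ` is continuous and positive).
[cite: Hou2026, §3 (dynamic rescaling formulation; scaling formulas for C_u, C_l)] -/
theorem exists_lengthFactor_le_mul_rpow_clockFactor_of_eventually (hcu : Continuous cu)
    (hcl : Continuous cl) {γ τ₀ : ℝ} (hratio : ∀ s, τ₀ ≤ s → γ * (-cu s) ≤ cl s) :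
    ∃ K : ℝ, 0 < K ∧ ∀ τ, 0 ≤ τ →
      rescalingFactor (fun s => -cl s) τ ≤ K * rescalingFactor cu τ ^ γ := by
  -- the continuous positive quotient `q = C_l / C_u^γ`
  set q : ℝ → ℝ := fun τ => rescalingFactor (fun s => -cl s) τ / rescalingFactor cu τ ^ γ with hq
  have hqpos : ∀ τ, 0 < q τ := fun τ =>
    div_pos (rescalingFactor_pos _ τ) (Real.rpow_pos_of_pos (rescalingFactor_pos cu τ) _)
  have hqcont : Continuous q :=
    (continuous_rescalingFactor hcl.neg).div
      ((continuous_rescalingFactor hcu).rpow_const fun τ => Or.inl (rescalingFactor_pos cu τ).ne')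
      fun τ => (Real.rpow_pos_of_pos (rescalingFactor_pos cu τ) _).ne'
  have hq_le : ∀ τ, rescalingFactor (fun s => -cl s) τ ≤ q τ * rescalingFactor cu τ ^ γ := by
    intro τ
    rw [hq, div_mul_cancel₀ _ (Real.rpow_pos_of_pos (rescalingFactor_pos cu τ) _).ne']
  -- compactness on `[0, τ₀]`
  obtain ⟨K₁, hK₁⟩ := isCompact_Icc.exists_bound_of_continuousOn (hqcont.continuousOn (s := Icc 0 τ₀))
  -- monotonicity on `[τ₀, ∞)`: `q τ ≤ q τ₀`
  have hmono : ∀ τ, τ₀ ≤ τ → q τ ≤ q τ₀ := by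
    intro τ hτ
    have hCu := rescalingFactor_pos cu τ
    have hCu0 := rescalingFactor_pos cu τ₀
    rw [hq]
    dsimp only
    rw [div_le_div_iff₀ (Real.rpow_pos_of_pos hCu _) (Real.rpow_pos_of_pos hCu0 _)]
    -- unfold the factors and split the integrals at `τ₀`
    unfold rescalingFactor
    rw [← Real.exp_mul, ← Real.exp_mul, ← Real.exp_add, ← Real.exp_add, Real.exp_le_exp]
    have hl : (∫ s in (0 : ℝ)..τ, -cl s) = (∫ s in (0 : ℝ)..τ₀, -cl s) + ∫ s in τ₀..τ, -cl s :=
      (integral_add_adjacent_intervals (hcl.neg.intervalIntegrable _ _)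
        (hcl.neg.intervalIntegrable _ _)).symm
    have hu : (∫ s in (0 : ℝ)..τ, cu s) = (∫ s in (0 : ℝ)..τ₀, cu s) + ∫ s in τ₀..τ, cu s :=
      (integral_add_adjacent_intervals (hcu.intervalIntegrable _ _)
        (hcu.intervalIntegrable _ _)).symm
    have hmon : (∫ s in τ₀..τ, -cl s) ≤ ∫ s in τ₀..τ, γ * cu s :=
      intervalIntegral.integral_mono_on hτ (hcl.neg.intervalIntegrable _ _)
        ((continuous_const.mul hcu).intervalIntegrable _ _) fun s hs => by
          have h := hratio s hs.1
          linarith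
    rw [intervalIntegral.integral_const_mul] at hmon
    rw [hl, hu]
    nlinarith [hmon]
  refine ⟨max K₁ (q τ₀), lt_max_of_lt_right (hqpos τ₀), fun τ hτ => (hq_le τ).trans ?_⟩
  refine mul_le_mul_of_nonneg_right ?_ (Real.rpow_nonneg (rescalingFactor_pos cu τ).le _)
  rcases le_or_gt τ τ₀ with h | h
  · have hb := hK₁ τ ⟨hτ, h⟩
    rw [Real.norm_of_nonneg (hqpos τ).le] at hb
    exact hb.trans (le_max_left _ _)
  · exact (hmono τ h.le).trans (le_max_right _ _)

variable {X : Type*} {F : ℝ → X → ℝ} {M : ℝ}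

/-- **Sub-Leray envelope from a dominated length clock.** If `−b ≤ c_u ≤ −a < 0` on `[0, ∞)`,
`C_l(τ) ≤ K C_u(τ)^γ` for `τ ≥ 0` (`K ≥ 0`, `γ ≥ ½`), and a nonnegative size functional has
bounded rescaled profile in the velocity normalisation, `(C_u/C_l)(τ) F(t(τ), x) ≤ M`, then
`F(s, x) ≤ M K b^{γ−½} a^{−½} (T − s)^{γ−1}` for `s ∈ [0, T)` (`speed_le_of_rescaling` is the
case `K = 1`). [cite: Hou2026, §3 (rescaled profiles; scaling formulas 1/C_u = 1/(T−t),
C_lz = (T−t)^{ĉ_lz})] -/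
theorem speed_le_of_lengthFactor_le (hcu : Continuous cu) {a b : ℝ} (ha : 0 < a)
    (hca : ∀ s, 0 ≤ s → cu s ≤ -a) (hcb : ∀ s, 0 ≤ s → -b ≤ cu s) {γ : ℝ} (hγ : 1 / 2 ≤ γ)
    {K : ℝ} (hK : 0 ≤ K)
    (hKl : ∀ τ, 0 ≤ τ → rescalingFactor (fun s => -cl s) τ ≤ K * rescalingFactor cu τ ^ γ)
    (hF0 : ∀ s x, 0 ≤ F s x)
    (hF : ∀ τ, 0 ≤ τ → ∀ x, rescalingFactor cu τ / rescalingFactor (fun s => -cl s) τ *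
      F (rescaledTime (rescalingFactor cu) τ) x ≤ M)
    {s : ℝ} (hs : s ∈ Ico 0 (blowupTime (rescalingFactor cu))) (x : X) :
    F s x ≤ M * K * (b ^ (γ - 1 / 2) * a ^ (-(1 / 2 : ℝ))) *
      (blowupTime (rescalingFactor cu) - s) ^ (γ - 1) := by
  obtain ⟨τ, hτ, rfl⟩ := exists_rescaledTime_eq_of_mem_Ico (continuous_rescalingFactor hcu)
    (integrableOn_rescalingFactor hcu ha hca) hs
  have hCu := rescalingFactor_pos cu τ
  have hCl := rescalingFactor_pos (fun s => -cl s) τ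
  have h1 := hF τ hτ x
  have h0 := hF0 (rescaledTime (rescalingFactor cu) τ) x
  have hM : 0 ≤ M := le_trans (mul_nonneg (div_pos hCu hCl).le h0) h1
  -- `F ≤ M C_l / C_u ≤ M K C_u^{γ−1}`
  have h2 : F (rescaledTime (rescalingFactor cu) τ) x ≤
      M * (rescalingFactor (fun s => -cl s) τ / rescalingFactor cu τ) := by
    rw [div_mul_eq_mul_div, div_le_iff₀ hCl] at h1
    rw [← mul_div_assoc, le_div_iff₀ hCu]
    linarith
  have h3 : rescalingFactor (fun s => -cl s) τ / rescalingFactor cu τ ≤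
      K * rescalingFactor cu τ ^ (γ - 1) := by
    rw [Real.rpow_sub hCu, Real.rpow_one, ← mul_div_assoc]
    exact div_le_div_of_nonneg_right (hKl τ hτ) hCu.le
  have h4 := rpow_clockFactor_le_of_pinned_clock hcu ha hca hcb hγ hτ
  calc F (rescaledTime (rescalingFactor cu) τ) x
      ≤ M * (K * rescalingFactor cu τ ^ (γ - 1)) := h2.trans (mul_le_mul_of_nonneg_left h3 hM)
    _ ≤ M * (K * ((b ^ (γ - 1 / 2) * a ^ (-(1 / 2 : ℝ))) *
        (blowupTime (rescalingFactor cu) - rescaledTime (rescalingFactor cu) τ) ^ (γ - 1))) :=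
        mul_le_mul_of_nonneg_left (mul_le_mul_of_nonneg_left h4 hK) hM
    _ = M * K * (b ^ (γ - 1 / 2) * a ^ (-(1 / 2 : ℝ))) *
        (blowupTime (rescalingFactor cu) - rescaledTime (rescalingFactor cu) τ) ^ (γ - 1) := by
        ring

/-- **No blow-up at the lifespan along a clock with dominated length clock** (`K`-version of
`not_isMaximalSmoothSolution_of_rescaling_of_half_lt`): `ν > 0`, `−b ≤ c_u ≤ −a < 0` on `[0, ∞)`,
`C_l ≤ K C_u^γ` on `[0, ∞)` with `γ > ½`, a maximal smooth Leray–Hopf solution of lifespan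
`T = t(∞)` with bounded rescaled speed `(C_u/C_l)(τ) |u(t(τ), x)| ≤ M` ⇒ `False`
(`speed_le_of_lengthFactor_le` + `not_isMaximalSmoothSolution_of_subLeray_envelope`).
[cite: Leray1934, §19 (3.8)–(3.9) p. 224] -/
theorem not_isMaximalSmoothSolution_of_lengthFactor_le {ν : ℝ} (hν : 0 < ν)
    (hcu : Continuous cu) {a b : ℝ} (ha : 0 < a) (hca : ∀ s, 0 ≤ s → cu s ≤ -a)
    (hcb : ∀ s, 0 ≤ s → -b ≤ cu s) {γ : ℝ} (hγ : 1 / 2 < γ) {K : ℝ} (hK : 0 ≤ K)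
    (hKl : ∀ τ, 0 ≤ τ → rescalingFactor (fun s => -cl s) τ ≤ K * rescalingFactor cu τ ^ γ)
    {u : ℝ → EuclideanSpace ℝ (Fin 3) → EuclideanSpace ℝ (Fin 3)}
    {p : ℝ → EuclideanSpace ℝ (Fin 3) → ℝ}
    (hmax : IsMaximalSmoothSolution ν 0 u p (blowupTime (rescalingFactor cu)))
    (hLH : IsLerayHopfOn (blowupTime (rescalingFactor cu)) ν 0 (u 0) u) {M : ℝ}
    (hM : ∀ τ, 0 ≤ τ → ∀ x, rescalingFactor cu τ / rescalingFactor (fun s => -cl s) τ *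
      ‖u (rescaledTime (rescalingFactor cu) τ) x‖ ≤ M) : False :=
  not_isMaximalSmoothSolution_of_subLeray_envelope hν
    (blowupTime_pos (continuous_rescalingFactor hcu) (rescalingFactor_pos cu)
      (integrableOn_rescalingFactor hcu ha hca)) hγ hmax hLH
    (fun _ hs x => speed_le_of_lengthFactor_le hcu ha hca hcb hγ.le hK hKl
      (fun _ _ => norm_nonneg _) hM hs x)

/-- **No blow-up at the lifespan for a ratio pinned above `½` after a transient.** As
`not_isMaximalSmoothSolution_of_rescaling_of_half_lt`, but with the ratio hypothesis
`γ (−c_u(s)) ≤ c_l(s)` (`γ > ½`) required only for `s ≥ τ₀` (any `τ₀`): `ν > 0`,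
`−b ≤ c_u ≤ −a < 0` on `[0, ∞)`, a maximal smooth Leray–Hopf solution of the unforced system with
lifespan `T = t(∞)` and bounded rescaled speed `(C_u/C_l)(τ) |u(t(τ), x)| ≤ M` for all `τ ≥ 0`
⇒ `False`. Read contrapositively along a computed clock: if the solution does blow up at `t(∞)`
and the rescaled speed stays bounded, the fit `ĉ_l(τ)` returns below every `γ > ½` at arbitrarily
late rescaled times (`liminf ĉ_l ≤ ½`). [cite: Leray1934, §19 (3.8)–(3.9) p. 224] -/
theorem not_isMaximalSmoothSolution_of_rescaling_of_eventually_half_lt {ν : ℝ} (hν : 0 < ν)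
    (hcu : Continuous cu) (hcl : Continuous cl) {a b : ℝ} (ha : 0 < a)
    (hca : ∀ s, 0 ≤ s → cu s ≤ -a) (hcb : ∀ s, 0 ≤ s → -b ≤ cu s) {γ τ₀ : ℝ} (hγ : 1 / 2 < γ)
    (hratio : ∀ s, τ₀ ≤ s → γ * (-cu s) ≤ cl s)
    {u : ℝ → EuclideanSpace ℝ (Fin 3) → EuclideanSpace ℝ (Fin 3)}
    {p : ℝ → EuclideanSpace ℝ (Fin 3) → ℝ}
    (hmax : IsMaximalSmoothSolution ν 0 u p (blowupTime (rescalingFactor cu)))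
    (hLH : IsLerayHopfOn (blowupTime (rescalingFactor cu)) ν 0 (u 0) u) {M : ℝ}
    (hM : ∀ τ, 0 ≤ τ → ∀ x, rescalingFactor cu τ / rescalingFactor (fun s => -cl s) τ *
      ‖u (rescaledTime (rescalingFactor cu) τ) x‖ ≤ M) : False := by
  obtain ⟨K, hK, hKl⟩ :=
    exists_lengthFactor_le_mul_rpow_clockFactor_of_eventually hcu hcl hratio
  exact not_isMaximalSmoothSolution_of_lengthFactor_le hν hcu ha hca hcb hγ hK.le hKl hmax hLH hM

/-- **The liminf reading.** Contrapositive of the previous theorem in the form read on a series: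
under the same clock and boundedness hypotheses, for a maximal smooth Leray–Hopf solution of
lifespan `t(∞)`, for every `γ > ½` and every `τ₀` there is a rescaled time `s ≥ τ₀` at which
the ratio is below `γ`: `c_l(s) < γ (−c_u(s))` (`ĉ_l(s) < γ`). [cite: Leray1934, §19 (3.8)–(3.9)
p. 224] -/
theorem exists_ratio_lt_of_isMaximalSmoothSolution {ν : ℝ} (hν : 0 < ν) (hcu : Continuous cu)
    (hcl : Continuous cl) {a b : ℝ} (ha : 0 < a) (hca : ∀ s, 0 ≤ s → cu s ≤ -a)
    (hcb : ∀ s, 0 ≤ s → -b ≤ cu s)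
    {u : ℝ → EuclideanSpace ℝ (Fin 3) → EuclideanSpace ℝ (Fin 3)}
    {p : ℝ → EuclideanSpace ℝ (Fin 3) → ℝ}
    (hmax : IsMaximalSmoothSolution ν 0 u p (blowupTime (rescalingFactor cu)))
    (hLH : IsLerayHopfOn (blowupTime (rescalingFactor cu)) ν 0 (u 0) u) {M : ℝ}
    (hM : ∀ τ, 0 ≤ τ → ∀ x, rescalingFactor cu τ / rescalingFactor (fun s => -cl s) τ *
      ‖u (rescaledTime (rescalingFactor cu) τ) x‖ ≤ M)
    {γ : ℝ} (hγ : 1 / 2 < γ) (τ₀ : ℝ) :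
    ∃ s, τ₀ ≤ s ∧ cl s < γ * (-cu s) := by
  by_contra h
  push Not at h
  exact not_isMaximalSmoothSolution_of_rescaling_of_eventually_half_lt hν hcu hcl ha hca hcb hγ
    h hmax hLH hM

end Clock

end Literature.Analysis.FluidPDE

end
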